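/-
Copyright (c) 2026 the pub-hodgecm-mathlib formalisation cell (harness21).  Prover seat hodgecm-mathlib-A-p12 (g25): road «S3-ram» (LEAD F0P3a-plan (g13); (Cnt2′) chair
F0P3a-p07 (g15) RULING (13) organ (4b), RULING (16)(a) regime B; (α) keeper F0P3a-p06 (g16)); organ (K4b) of the (4b) decomposition, PART 1/2 (the frame); 2026-09-02.
-/
import Literature.NumberTheory.Rogawski1990.DepthZeroKappaTransferTypeTwoRamifiedBlockVertexCensus      -- ★ (K4a) 3/3 (this seat): per-vertex census in an adapted block frame; brings (K4a) 1–2, (K2), (K3)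
import Literature.NumberTheory.Automorphic.UnitaryLatticeTreeBlockRootRegionAxis                      -- ★ p849125 (F0P3a-p01 (g18)): `single_one_one_mem_of_mem_rootRegion_of_coe_eq_endoGL`; brings the axis transport
import Literature.NumberTheory.Automorphic.UnitaryLatticeTreeSelfDualTransitiveTwo                    -- ★ rank-2 self-dual transitivity `exists_unitary_mapGL_stdLattice_eq_of_isSelfDualLattice_two_of_v_two`
import Literature.NumberTheory.Automorphic.UnitaryLatticeTreeFrameLiteralCentring                     -- ★ (A-p19 (g29)): `endoGL_mem_unitaryGroupOfForm_antidiagonal_three`, `endoGL_one_mem_unitaryInt`, root level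
import Literature.NumberTheory.Automorphic.UnitaryLatticeTreeRootStarPredicateCountRamified           -- ★ `exists_unit_v_sub_mul_sq_lt_one_iff_residue`
import Literature.NumberTheory.Rogawski1990.DepthZeroKappaTransferTypeOneRamifiedRootLineCountsLattice  -- ★ `exists_ne_zero_eq_mul_sq_iff_quadraticChar`
import Literature.NumberTheory.Automorphic.UnitaryGroupRankOneBigCell                                 -- ★ `antidiagonal_three_over_eq`
import HarnessLib

/-!
# The ramified `κ`-orbital integral, TYPE (2): THE ADAPTED AXIS FRAME OF A REGION VERTEX OF THE HYPERBOLIC BLOCK LITERAL, and the KIND TOKENS read on it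
# (organ (4b), part (K4b) 1/2; Kottwitz 1986 §3; Rogawski 1990 §4.9; Bruhat–Tits 1972 §10)

Topic `NumberTheory/Rogawski1990`; namespace `Literature.NumberTheory.Rogawski1990.TypeOneRamifiedJunction`.  THEOREMS ONLY (no definition, no instance, no notation, no
named fact, no `sorry`); kernel lane `--supports stmt-HodgeConjecture-24833`; datum-free (`K` with `Valued K ℤᵐ⁰`).  Cell `pub/hodgecm-mathlib` (D-0151), crux H413; road
«S3-ram» (count-neutral); (Cnt2′) ROUTE B, chair RULING (13) organ **(4b) «PER-KIND VALUES over the W-ball»**, RULING (16)(a) «regime B» (A-p12 (g25)), part (K4b).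
The hyperbolic literal in the centred `J₀`-model is `Γ = ι(B₀, 1)` (`↑γ = endoGL (B₀, 1)`, ★ A-p19 (g29) `endoGL_rerootedCentred_mem_unitaryGroupOfForm_ram`), REGIME B:
`|(B₀ − 1)ᵢⱼ| ≤ |ϖ|^{d₀}`, `|½tr B₀ − 1| = |ϖ|^{d₀}` (`d₀ = m = d_c`), `|tr(B₀)² − 4det B₀| < |ϖ|^{2d₀}` (`d₀ < N`), `d₀` odd.  This file supplies what ★ (K4a)
`blockVertexCensus_{shell,inner}` consume AT EVERY REGION VERTEX `v ∈ R = {v ∣ γ·v = v ∧ SD v.1 ∧ LEV_v(ϖ^{d₀})}`: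
* §1 `v_det_coe_sub_one_eq_of_regimeB` — `|det(B₀ − 1)| = |ϖ|^{2d₀}` (so ★ p849125 puts `R` on the AXIS `e₁ ∈ v.1`);
* §2 **`exists_adaptedAxisFrame_of_mem_rootRegion`** — `v = ι(k,1)·r₀` with `k ∈ U(σ, Φ₂)` and `↑(u⁻¹γu) = ι(g₁, 1)`, `g₁ = k⁻¹B₀k` DEEP, ADAPTED, J-SYMMETRIC (★ p849125 ∘
  ★ `exists_latt_endoGL_eq_of_single_mem` ∘ ★ rank-2 transitivity ∘ ★ (K3) `residue_apply_eq_and_offDiag_dichotomy_of_unitary_two`, flipping `k ↦ k·w₀` if needed);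
* §3 the KIND TOKENS of the (4a)/(K5-B-J) heads READ ON THE FRAME: `res CO = −res T₀ ≠ 0` (`T₀ = ϖ^{−d₀}(½tr B₀ − 1)`), the LOCK `Λ(c₁) ⟺ χ((res nc₁)⁻¹·res CO) = 1`,
  INNER `Pin v ⟺ res LO = 0`, and at a shell vertex BIG `Qbig v ⟺ χ(−res LO·res CO) = 1`.
HONEST LABEL: HC_CM is proved only modulo the 2 remaining named inputs (hLiu418 24832, h413 24833) until rung 0 closes; nothing printed is asserted here (lattice
bookkeeping over ★ results); «S3-ram» is Literature seeding, count-neutral.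

## References
* [Kottwitz1986] R. E. Kottwitz, *Base change for unit elements of Hecke algebras*, Compositio Math. 60 (1986), §3.
* [Rogawski1990] J. D. Rogawski, *Automorphic Representations of Unitary Groups in Three Variables*, Ann. of Math. Stud. 123 (1990), §4.8 Case (a) p. 53, §4.9 pp. 54–56, Lemma 4.9.3.
* [BruhatTits1972] F. Bruhat, J. Tits, *Groupes réductifs sur un corps local I*, Publ. Math. IHÉS 41 (1972), §10.
* [LabesseLanglands1979] J.-P. Labesse, R. P. Langlands, *L-indistinguishability for SL(2)*, Canad. J. Math. 31 (1979), §2.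
* [Jacobowitz1962] R. Jacobowitz, *Hermitian forms over local fields*, Amer. J. Math. 84 (1962), §7–§8.
-/

set_option autoImplicit false

noncomputable section

open scoped Valued WithZero Matrix MatrixGroups
open Polynomial Classical SimpleGraph
open Literature.NumberTheory.Automorphic Literature.NumberTheory.Automorphic.HermitianLattice Literature.NumberTheory.Automorphic.UnitaryLatticeTree
open Literature.NumberTheory.Automorphic.UnitaryGroup

namespace Literature.NumberTheory.Rogawski1990.TypeOneRamifiedJunction

variable {K : Type*} [Field K] [Valued K ℤᵐ⁰] {σ : K →+* K} {ϖ : K}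

/-! ## §1 Regime B puts the region on the axis: `|det(B₀ − 1)| = |ϖ|^{2d₀}` -/

omit [Valued K ℤᵐ⁰] in
/-- `det(B − 1) = (½tr B − 1)² − ¼(tr(B)² − 4det B)` for a `2 × 2` matrix (`2 ≠ 0`). [cite: Rogawski1990, §4.9 p. 55] -/
theorem det_sub_one_eq_of_two (h2 : (2 : K) ≠ 0) (B : Matrix (Fin 2) (Fin 2) K) :
    (B - 1).det = (B.trace / 2 - 1) ^ 2 - (B.trace ^ 2 - 4 * B.det) / 4 := by
  have h4 : (4 : K) ≠ 0 := by
    rw [show (4 : K) = 2 * 2 by norm_num]; exact mul_ne_zero h2 h2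
  rw [Matrix.det_fin_two, Matrix.det_fin_two, Matrix.trace_fin_two]
  simp only [Matrix.sub_apply, Matrix.one_apply_eq, Matrix.one_apply_ne (show (0 : Fin 2) ≠ 1 by decide),
    Matrix.one_apply_ne (show (1 : Fin 2) ≠ 0 by decide), sub_zero]
  field_simp
  ring

/-- **REGIME B: `|det(B₀ − 1)| = |ϖ|^{2d₀}`** from `|½tr B₀ − 1| = |ϖ|^{d₀}` and `|tr(B₀)² − 4det B₀| < |ϖ|^{2d₀}` (`|2| = 1`). [cite: Rogawski1990, §4.9 Lemma 4.9.3 p. 56] [cite: Kottwitz1986, §3] -/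
theorem v_det_coe_sub_one_eq_of_regimeB (h2 : Valued.v (2 : K) = 1) (B₀ : Matrix (Fin 2) (Fin 2) K) {d₀ : ℕ}
    (hdisc : Valued.v (B₀.trace ^ 2 - 4 * B₀.det) < Valued.v ϖ ^ (2 * d₀)) (hcB : Valued.v (B₀.trace / 2 - 1) = Valued.v ϖ ^ d₀) :
    Valued.v (B₀ - 1).det = Valued.v ϖ ^ (2 * d₀) := by
  have h20 : (2 : K) ≠ 0 := fun h0 => by rw [h0, map_zero] at h2; exact zero_ne_one h2
  have h4 : Valued.v (4 : K) = 1 := by rw [show (4 : K) = 2 * 2 by norm_num, map_mul, h2, one_mul]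
  have hA : Valued.v ((B₀.trace / 2 - 1) ^ 2) = Valued.v ϖ ^ (2 * d₀) := by rw [map_pow, hcB, ← pow_mul, mul_comm]
  have hB : Valued.v (-((B₀.trace ^ 2 - 4 * B₀.det) / 4)) < Valued.v ((B₀.trace / 2 - 1) ^ 2) := by
    rw [Valuation.map_neg, map_div₀, h4, div_one, hA]; exact hdisc
  rw [det_sub_one_eq_of_two h20, sub_eq_add_neg, Valuation.map_add_eq_of_lt_left _ hB, hA]

/-- **The `hdet` slot of ★ `single_one_one_mem_of_mem_rootRegion_of_coe_eq_endoGL` at `Γ = ι(B₀, 1)` in regime B**: `|ϖ|^{2d₀+1} < |det(B₀ − u₀₀·1)|` with `u = 1`.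
[cite: Rogawski1990, §4.9 Lemma 4.9.3 p. 56] [cite: Kottwitz1986, §3] -/
theorem lt_v_det_coe_sub_smul_one_of_regimeB (hϖ : Valued.v ϖ = WithZero.exp (-1 : ℤ)) (h2 : Valued.v (2 : K) = 1) (B₀ : GL (Fin 2) K) {d₀ : ℕ}
    (hdisc : Valued.v ((B₀ : Matrix (Fin 2) (Fin 2) K).trace ^ 2 - 4 * (B₀ : Matrix (Fin 2) (Fin 2) K).det) < Valued.v ϖ ^ (2 * d₀))
    (hcB : Valued.v ((B₀ : Matrix (Fin 2) (Fin 2) K).trace / 2 - 1) = Valued.v ϖ ^ d₀) :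
    Valued.v ϖ ^ (2 * d₀ + 1) <
      Valued.v (((B₀ : Matrix (Fin 2) (Fin 2) K) - ((1 : GL (Fin 1) K) : Matrix (Fin 1) (Fin 1) K) 0 0 • (1 : Matrix (Fin 2) (Fin 2) K)).det) := by
  have hvϖ0 : Valued.v ϖ ≠ 0 := by rw [hϖ]; exact WithZero.coe_ne_zero
  have hϖ1 : Valued.v ϖ < 1 := by rw [hϖ, ← WithZero.exp_zero]; exact WithZero.exp_lt_exp.2 (by norm_num)
  rw [Units.val_one, Matrix.one_apply_eq, one_smul, v_det_coe_sub_one_eq_of_regimeB h2 _ hdisc hcB]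
  exact pow_lt_pow_right_of_lt_one₀ (zero_lt_iff.2 hvϖ0) hϖ1 (by omega)

/-! ## §2 The adapted AXIS block frame of a region vertex -/

omit [Valued K ℤᵐ⁰] in
/-- The middle coordinate is untouched by an axis frame: `(ι(k, 1)·x)₁ = x₁`. [cite: Rogawski1990, §4.8 Case (a) p. 53] -/
theorem coe_endoGL_one_mulVec_apply_one (k : GL (Fin 2) K) (x : Fin 3 → K) :
    (((endoGL (k, (1 : GL (Fin 1) K)) : GL (Fin 3) K) : Matrix (Fin 3) (Fin 3) K) *ᵥ x) 1 = x 1 := by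
  rw [coe_endoGL_mulVec_apply, Units.val_one, Matrix.one_apply_eq, one_mul]; rfl

omit [Valued K ℤᵐ⁰] in
/-- Conjugating the block literal by an axis frame: `ι(k,1)⁻¹ · ι(B₀,1) · ι(k,1) = ι(k⁻¹B₀k, 1)`. [cite: Rogawski1990, §4.8 Case (a) p. 53] -/
theorem endoGL_one_inv_mul_endoGL_one_mul_endoGL_one (k B₀ : GL (Fin 2) K) :
    (endoGL (k, (1 : GL (Fin 1) K)))⁻¹ * endoGL (B₀, (1 : GL (Fin 1) K)) * endoGL (k, (1 : GL (Fin 1) K)) = endoGL (k⁻¹ * B₀ * k, (1 : GL (Fin 1) K)) := by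
  rw [← map_inv, ← map_mul, ← map_mul]
  congr 1
  ext <;> simp

set_option maxHeartbeats 1600000 in
/-- **(K4b-F) THE ADAPTED AXIS BLOCK FRAME OF A REGION VERTEX.**  Let `↑γ = ι(B₀, 1)` be the hyperbolic block literal in REGIME B (`|tr(B₀)² − 4det B₀| < |ϖ|^{2d₀}`,
`|½tr B₀ − 1| = |ϖ|^{d₀}`, `d₀` odd, `|2| = 1`, tame ramified `σϖ = −ϖ`).  Then every vertex `v` of the root region (`γ·v = v`, `SD v.1`, `(γ − 1)·v.1 ≤ ϖ^{d₀}·v.1`)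
is `v = u·r₀` for an AXIS frame `u = ι(k, 1)`, `k ∈ U(σ, Φ₂)`, in which `γ` is BLOCK `↑(u⁻¹γu) = ι(g₁, 1)` with `tr g₁ = tr B₀`, `det g₁ = det B₀`, DEEP `|(g₁ − 1)ᵢⱼ| ≤ |ϖ|^{d₀}`,
ADAPTED `|ϖ^{−d₀}g₁,₁₀| < 1` and J-SYMMETRIC `|ϖ^{−d₀}((g₁−1)₀₀ − (g₁−1)₁₁)| < 1` — the frame binders `(u hvu g₁ u′ hγu hadapt hsym)` of ★ (K4a) `blockVertexCensus_{shell,inner}`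
with `u′ = 1`.  Route: `e₁ ∈ v.1` (★ p849125, §1) ⇒ `v.1 = latt ι(g₂,1)` (★ `exists_latt_endoGL_eq_of_single_mem`) ⇒ `latt g₂ = k·𝒪²`, `k ∈ U(σ,Φ₂)` (★ rank-2 transitivity) ⇒
J-symmetry and the off-diagonal dichotomy of `k⁻¹B₀k` (★ (K3)), flipping `k ↦ k·w₀` in the non-adapted case. [cite: BruhatTits1972, §10] [cite: Kottwitz1986, §3]
[cite: Rogawski1990, §4.9 Lemma 4.9.3 p. 56] [cite: Jacobowitz1962, §8] -/
theorem exists_adaptedAxisFrame_of_mem_rootRegion [IsPrincipalIdealRing 𝒪[K]]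
    (hσ : ∀ x, σ (σ x) = x) (hvσ : ∀ a, Valued.v (σ a) = Valued.v a) (hσϖ : σ ϖ = -ϖ)
    (hϖ : Valued.v ϖ = WithZero.exp (-1 : ℤ)) (hres : ∀ x : K, Valued.v x ≤ 1 → Valued.v (σ x - x) < 1) (h2 : Valued.v (2 : K) = 1)
    (γ : unitaryGroupOfForm σ ((StdForm.antidiagonal 3).over K)) (B₀ : GL (Fin 2) K) (hγ : (γ : GL (Fin 3) K) = endoGL (B₀, (1 : GL (Fin 1) K)))
    {d₀ : ℕ} (hodd : Odd d₀)
    (hdisc : Valued.v ((B₀ : Matrix (Fin 2) (Fin 2) K).trace ^ 2 - 4 * (B₀ : Matrix (Fin 2) (Fin 2) K).det) < Valued.v ϖ ^ (2 * d₀))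
    (hcB : Valued.v ((B₀ : Matrix (Fin 2) (Fin 2) K).trace / 2 - 1) = Valued.v ϖ ^ d₀)
    {v : {M : Submodule 𝒪[K] (Fin 3 → K) // IsVertex σ ϖ ((StdForm.antidiagonal 3).over K) M}}
    (hfix : latticeGraphIso σ ϖ ((StdForm.antidiagonal 3).over K) γ v = v) (hv : IsSelfDualLattice σ ϖ ((StdForm.antidiagonal 3).over K) v.1)
    (hvR : v.1.map ((Matrix.toLin' (((γ : GL (Fin 3) K) : Matrix (Fin 3) (Fin 3) K) - 1)).restrictScalars 𝒪[K]) ≤ scaleLattice (ϖ ^ d₀) v.1) :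
    ∃ k : GL (Fin 2) K, k ∈ unitaryGroupOfForm σ ((StdForm.antidiagonal 2).over K) ∧
      ∃ u : unitaryGroupOfForm σ ((StdForm.antidiagonal 3).over K), (u : GL (Fin 3) K) = endoGL (k, (1 : GL (Fin 1) K)) ∧
        v = latticeGraphIso σ ϖ ((StdForm.antidiagonal 3).over K) u ⟨stdLattice K 3, 0, isSelfDualLattice_stdLattice_three_of_v hϖ⟩ ∧
        ∃ g₁ : GL (Fin 2) K, ((u⁻¹ * γ * u : unitaryGroupOfForm σ ((StdForm.antidiagonal 3).over K)) : GL (Fin 3) K) = endoGL (g₁, (1 : GL (Fin 1) K)) ∧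
          (g₁ : Matrix (Fin 2) (Fin 2) K).trace = (B₀ : Matrix (Fin 2) (Fin 2) K).trace ∧ (g₁ : Matrix (Fin 2) (Fin 2) K).det = (B₀ : Matrix (Fin 2) (Fin 2) K).det ∧
          (∀ i j, Valued.v (((g₁ : Matrix (Fin 2) (Fin 2) K) - 1) i j) ≤ Valued.v ϖ ^ d₀) ∧
          Valued.v ((ϖ ^ d₀)⁻¹ * (g₁ : Matrix (Fin 2) (Fin 2) K) 1 0) < 1 ∧
          Valued.v ((ϖ ^ d₀)⁻¹ * ((((g₁ : Matrix (Fin 2) (Fin 2) K) - 1) 0 0) - (((g₁ : Matrix (Fin 2) (Fin 2) K) - 1) 1 1))) < 1 := by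
  have hϖ0 : ϖ ≠ 0 := fun h0 => by rw [h0, map_zero] at hϖ; exact WithZero.coe_ne_zero hϖ.symm
  have hvϖ0 : Valued.v ϖ ≠ 0 := (Valuation.ne_zero_iff _).2 hϖ0
  have hϖ1 : Valued.v ϖ ≤ 1 := by rw [hϖ, ← WithZero.exp_zero]; exact WithZero.exp_le_exp.2 (by norm_num)
  have hϖD0 : (ϖ ^ d₀ : K) ≠ 0 := pow_ne_zero _ hϖ0
  -- (a) the vertex is an axis vertex
  have he : (Pi.single 1 1 : Fin 3 → K) ∈ v.1 :=
    single_one_one_mem_of_mem_rootRegion_of_coe_eq_endoGL hσ hvσ hϖ γ B₀ 1 hγ (lt_v_det_coe_sub_smul_one_of_regimeB hϖ h2 B₀ hdisc hcB) v ⟨hfix, hv, hvR⟩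
  -- (b) an endoscopic block frame of the lattice
  obtain ⟨g₃, hMg, -, -, -⟩ := id hv
  have hSD' : IsSelfDualLattice σ ϖ
      (!![(!![(0 : K), 1; 1, 0] : Matrix (Fin 2) (Fin 2) K) 0 0, 0, (!![(0 : K), 1; 1, 0] : Matrix (Fin 2) (Fin 2) K) 0 1; 0, (1 : K), 0;
        (!![(0 : K), 1; 1, 0] : Matrix (Fin 2) (Fin 2) K) 1 0, 0, (!![(0 : K), 1; 1, 0] : Matrix (Fin 2) (Fin 2) K) 1 1] : Matrix (Fin 3) (Fin 3) K) v.1 := by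
    rw [← antidiagonal_three_over_eq_endoShape]; exact hv
  have hH₂ : IsUnit (!![(0 : K), 1; 1, 0] : Matrix (Fin 2) (Fin 2) K).det := by rw [Matrix.det_fin_two]; simp
  have hHdet : IsUnit (!![(!![(0 : K), 1; 1, 0] : Matrix (Fin 2) (Fin 2) K) 0 0, 0, (!![(0 : K), 1; 1, 0] : Matrix (Fin 2) (Fin 2) K) 0 1; 0, (1 : K), 0;
        (!![(0 : K), 1; 1, 0] : Matrix (Fin 2) (Fin 2) K) 1 0, 0, (!![(0 : K), 1; 1, 0] : Matrix (Fin 2) (Fin 2) K) 1 1] : Matrix (Fin 3) (Fin 3) K).det := by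
    rw [← antidiagonal_three_over_eq_endoShape]; exact isUnit_det_antidiagonal
  have hax : ∀ x ∈ v.1, Valued.v (x 1) ≤ 1 := by
    intro x hx
    have hdual := dualLatt_eq_self_of_isSelfDualLattice hvσ hHdet hSD'
    have hx' : x ∈ dualLatt σ (!![(!![(0 : K), 1; 1, 0] : Matrix (Fin 2) (Fin 2) K) 0 0, 0, (!![(0 : K), 1; 1, 0] : Matrix (Fin 2) (Fin 2) K) 0 1; 0, (1 : K), 0;
        (!![(0 : K), 1; 1, 0] : Matrix (Fin 2) (Fin 2) K) 1 0, 0, (!![(0 : K), 1; 1, 0] : Matrix (Fin 2) (Fin 2) K) 1 1] : Matrix (Fin 3) (Fin 3) K) v.1 := by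
      rw [hdual]; exact hx
    have hp := hx' _ he
    rw [pairing_endoShape_apply] at hp
    have e0 : (![(Pi.single 1 1 : Fin 3 → K) 0, (Pi.single 1 1 : Fin 3 → K) 2] : Fin 2 → K) = 0 := by ext i; fin_cases i <;> simp
    rw [e0, map_zero, LinearMap.zero_apply, zero_add] at hp
    simpa using hp
  obtain ⟨g₂, hg₂⟩ := exists_latt_endoGL_eq_of_single_mem g₃ (by rw [← hMg]; exact he) (by rw [← hMg]; exact hax)
  -- (c) the W-block lattice is self-dual, hence `k·𝒪²` for a unitary `k`
  have hSD₂ : IsSelfDualLattice σ ϖ ((StdForm.antidiagonal 2).over K) (latt (g₂ : Matrix (Fin 2) (Fin 2) K)) := by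
    have hΦ₂ : (StdForm.antidiagonal 2).over K = !![(0 : K), 1; 1, 0] := by
      ext i j; fin_cases i <;> fin_cases j <;> simp [StdForm.over, StdForm.antidiagonal_J_apply]
    rw [hΦ₂, ← isSelfDualLattice_latt_endoGL_one_iff σ hvσ hϖ0 hϖ1 _ (h := (1 : K)) (by rw [map_one]) g₂, hg₂, ← hMg]
    exact hSD'
  obtain ⟨k, hk⟩ := exists_unitary_mapGL_stdLattice_eq_of_isSelfDualLattice_two_of_v_two hσ hvσ hϖ h2 hSD₂
  have hlatt₂ : latt (g₂ : Matrix (Fin 2) (Fin 2) K) = latt ((k : GL (Fin 2) K) : Matrix (Fin 2) (Fin 2) K) := hk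
  have hvk : v.1 = latt ((endoGL ((k : GL (Fin 2) K), (1 : GL (Fin 1) K)) : GL (Fin 3) K) : Matrix (Fin 3) (Fin 3) K) := by
    rw [hMg, ← hg₂]; exact (latt_endoGL_one_eq_iff _ _).2 hlatt₂
  -- (d) J-symmetry and the off-diagonal dichotomy of `k₁⁻¹ B₀ k₁` for ANY unitary `k₁` with `v = ι(k₁,1)·r₀`
  have key : ∀ k₁ : GL (Fin 2) K, k₁ ∈ unitaryGroupOfForm σ ((StdForm.antidiagonal 2).over K) →
      v.1 = latt ((endoGL (k₁, (1 : GL (Fin 1) K)) : GL (Fin 3) K) : Matrix (Fin 3) (Fin 3) K) →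
      ∃ u : unitaryGroupOfForm σ ((StdForm.antidiagonal 3).over K), (u : GL (Fin 3) K) = endoGL (k₁, (1 : GL (Fin 1) K)) ∧
        v = latticeGraphIso σ ϖ ((StdForm.antidiagonal 3).over K) u ⟨stdLattice K 3, 0, isSelfDualLattice_stdLattice_three_of_v hϖ⟩ ∧
        ((u⁻¹ * γ * u : unitaryGroupOfForm σ ((StdForm.antidiagonal 3).over K)) : GL (Fin 3) K) = endoGL (k₁⁻¹ * B₀ * k₁, (1 : GL (Fin 1) K)) ∧
        (∀ i j, Valued.v (((((k₁⁻¹ * B₀ * k₁ : GL (Fin 2) K)) : Matrix (Fin 2) (Fin 2) K) - 1) i j) ≤ Valued.v ϖ ^ d₀) ∧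
        Valued.v ((ϖ ^ d₀)⁻¹ * (((((k₁⁻¹ * B₀ * k₁ : GL (Fin 2) K)) : Matrix (Fin 2) (Fin 2) K) - 1) 0 0 - ((((k₁⁻¹ * B₀ * k₁ : GL (Fin 2) K)) : Matrix (Fin 2) (Fin 2) K) - 1) 1 1)) < 1 ∧
        (Valued.v ((ϖ ^ d₀)⁻¹ * (((k₁⁻¹ * B₀ * k₁ : GL (Fin 2) K)) : Matrix (Fin 2) (Fin 2) K) 1 0) < 1 ∨
          Valued.v ((ϖ ^ d₀)⁻¹ * (((k₁⁻¹ * B₀ * k₁ : GL (Fin 2) K)) : Matrix (Fin 2) (Fin 2) K) 0 1) < 1) := by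
    intro k₁ hk₁ hvk₁
    let u : unitaryGroupOfForm σ ((StdForm.antidiagonal 3).over K) :=
      ⟨endoGL (k₁, (1 : GL (Fin 1) K)), endoGL_mem_unitaryGroupOfForm_antidiagonal_three hk₁ (Subgroup.one_mem _)⟩
    have hu : (u : GL (Fin 3) K) = endoGL (k₁, (1 : GL (Fin 1) K)) := rfl
    have hvu : v = latticeGraphIso σ ϖ ((StdForm.antidiagonal 3).over K) u ⟨stdLattice K 3, 0, isSelfDualLattice_stdLattice_three_of_v hϖ⟩ := by
      apply Subtype.ext
      rw [latticeGraphIso_apply_coe, hvk₁]; rfl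
    have hγu : ((u⁻¹ * γ * u : unitaryGroupOfForm σ ((StdForm.antidiagonal 3).over K)) : GL (Fin 3) K) = endoGL (k₁⁻¹ * B₀ * k₁, (1 : GL (Fin 1) K)) := by
      rw [Subgroup.coe_mul, Subgroup.coe_mul, Subgroup.coe_inv, hu, hγ, endoGL_one_inv_mul_endoGL_one_mul_endoGL_one]
    -- depth from the region token
    have hvR' := hvR
    rw [hvu] at hvR'
    have hdeep3 := (forall_v_conj_sub_one_le_iff_map_sub_one_le_scaleLattice γ u hϖD0).1 hvR'
    rw [hγu, coe_endoGL_sub_one_eq_endoShape, forall_v_endoShape_le_iff, map_pow] at hdeep3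
    have hdeep := hdeep3.1
    -- the dichotomy (★ (K3))
    have hTint : ∀ i j, Valued.v ((ϖ ^ d₀)⁻¹ * ((((k₁⁻¹ * B₀ * k₁ : GL (Fin 2) K)) : Matrix (Fin 2) (Fin 2) K) - 1) i j) ≤ 1 := fun i j => by
      rw [map_mul, map_inv₀, map_pow]
      calc (Valued.v ϖ ^ d₀)⁻¹ * Valued.v (((((k₁⁻¹ * B₀ * k₁ : GL (Fin 2) K)) : Matrix (Fin 2) (Fin 2) K) - 1) i j) ≤ (Valued.v ϖ ^ d₀)⁻¹ * Valued.v ϖ ^ d₀ :=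
            mul_le_mul' le_rfl (hdeep i j)
        _ = 1 := inv_mul_cancel₀ (pow_ne_zero _ hvϖ0)
    obtain ⟨T, hT⟩ : ∃ T : Matrix (Fin 2) (Fin 2) 𝒪[K], ∀ i j, ((T i j : 𝒪[K]) : K) = (ϖ ^ d₀)⁻¹ * ((((k₁⁻¹ * B₀ * k₁ : GL (Fin 2) K)) : Matrix (Fin 2) (Fin 2) K) - 1) i j :=
      ⟨Matrix.of fun i j => ⟨_, (Valuation.mem_integer_iff _ _).2 (hTint i j)⟩, fun i j => rfl⟩
    have hunit : endoGL (k₁⁻¹ * B₀ * k₁, (1 : GL (Fin 1) K)) ∈ unitaryGroupOfForm σ ((StdForm.antidiagonal 3).over K) := by rw [← hγu]; exact (u⁻¹ * γ * u).2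
    have hdisc₁ : Valued.v ((((k₁⁻¹ * B₀ * k₁ : GL (Fin 2) K)) : Matrix (Fin 2) (Fin 2) K).trace ^ 2 - 4 * (((k₁⁻¹ * B₀ * k₁ : GL (Fin 2) K)) : Matrix (Fin 2) (Fin 2) K).det) <
        Valued.v ϖ ^ (2 * d₀) := by
      rw [Units.val_mul, Units.val_mul, Matrix.trace_units_conj', Matrix.det_units_conj']; exact hdisc
    obtain ⟨hsym, hdich⟩ := residue_apply_eq_and_offDiag_dichotomy_of_unitary_two hvσ hσϖ hϖ hres h2 _ (block_mem_unitary_of_endoGL_mem hunit) hodd T hT hdisc₁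
    have hsymv : Valued.v ((ϖ ^ d₀)⁻¹ * (((((k₁⁻¹ * B₀ * k₁ : GL (Fin 2) K)) : Matrix (Fin 2) (Fin 2) K) - 1) 0 0 - ((((k₁⁻¹ * B₀ * k₁ : GL (Fin 2) K)) : Matrix (Fin 2) (Fin 2) K) - 1) 1 1)) < 1 := by
      have h := hsym
      rw [← sub_eq_zero, ← map_sub, residue_eq_zero_iff_v_lt_one] at h
      simpa [hT, mul_sub] using h
    refine ⟨u, hu, hvu, hγu, hdeep, hsymv, ?_⟩
    rcases hdich with h10 | h01
    · left
      rw [residue_eq_zero_iff_v_lt_one, hT, Matrix.sub_apply, Matrix.one_apply_ne (by decide), sub_zero] at h10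
      exact h10
    · right
      rw [residue_eq_zero_iff_v_lt_one, hT, Matrix.sub_apply, Matrix.one_apply_ne (by decide), sub_zero] at h01
      exact h01
  -- (e) conclude, flipping the W-frame if necessary
  have htrdet : ∀ k₁ : GL (Fin 2) K, (((k₁⁻¹ * B₀ * k₁ : GL (Fin 2) K)) : Matrix (Fin 2) (Fin 2) K).trace = (B₀ : Matrix (Fin 2) (Fin 2) K).trace ∧
      (((k₁⁻¹ * B₀ * k₁ : GL (Fin 2) K)) : Matrix (Fin 2) (Fin 2) K).det = (B₀ : Matrix (Fin 2) (Fin 2) K).det := fun k₁ => by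
    rw [Units.val_mul, Units.val_mul, Matrix.trace_units_conj', Matrix.det_units_conj']; exact ⟨rfl, rfl⟩
  obtain ⟨u, hu, hvu, hγu, hdeep, hsymv, hdich⟩ := key (k : GL (Fin 2) K) k.2 hvk
  rcases hdich with h10 | h01
  · exact ⟨(k : GL (Fin 2) K), k.2, u, hu, hvu, (k : GL (Fin 2) K)⁻¹ * B₀ * (k : GL (Fin 2) K), hγu, (htrdet _).1, (htrdet _).2, hdeep, h10, hsymv⟩
  · -- flip: `k' = k·w₀`
    obtain ⟨w, hw, hw'⟩ := (exists_flipTwo : ∃ w : GL (Fin 2) K, _)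
    have hwU : w ∈ unitaryGroupOfForm σ ((StdForm.antidiagonal 2).over K) := by
      have h := endoGL_flip_one_mem_unitary σ hw
      rw [← endoForm_antidiagonal_over, endoGL_mem_iff] at h
      exact h.1
    have hkw : (k : GL (Fin 2) K) * w ∈ unitaryGroupOfForm σ ((StdForm.antidiagonal 2).over K) := Subgroup.mul_mem _ k.2 hwU
    have hvkw : v.1 = latt ((endoGL ((k : GL (Fin 2) K) * w, (1 : GL (Fin 1) K)) : GL (Fin 3) K) : Matrix (Fin 3) (Fin 3) K) := by
      rw [hvk]
      refine (latt_endoGL_one_eq_iff _ _).2 ?_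
      -- `latt (k w₀) = latt k`: `w₀ ∈ GL₂(𝒪)`
      rw [Units.val_mul, latt_mul]
      have hwl : latt ((w : GL (Fin 2) K) : Matrix (Fin 2) (Fin 2) K) = stdLattice K 2 := by
        apply le_antisymm
        · rw [latt_le_stdLattice_iff, hw]; intro i j; fin_cases i <;> fin_cases j <;> simp
        · have h1 : stdLattice K 2 = latt (((w : GL (Fin 2) K) : Matrix (Fin 2) (Fin 2) K) * ((w : GL (Fin 2) K) : Matrix (Fin 2) (Fin 2) K)) := by
            rw [← Units.val_mul, show w * w = 1 from by
              rw [← inv_eq_iff_mul_eq_one]; exact Units.ext (hw'.trans hw.symm), Units.val_one, latt_one]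
          rw [h1, latt_mul]
          refine Submodule.map_mono ?_
          rw [latt_le_stdLattice_iff, hw]; intro i j; fin_cases i <;> fin_cases j <;> simp
      rw [hwl]; rfl
    obtain ⟨u', hu', hvu', hγu', hdeep', hsymv', hdich'⟩ := key ((k : GL (Fin 2) K) * w) hkw hvkw
    have hre : ((k : GL (Fin 2) K) * w)⁻¹ * B₀ * ((k : GL (Fin 2) K) * w) = w⁻¹ * ((k : GL (Fin 2) K)⁻¹ * B₀ * k) * w := by group
    refine ⟨(k : GL (Fin 2) K) * w, hkw, u', hu', hvu', ((k : GL (Fin 2) K) * w)⁻¹ * B₀ * ((k : GL (Fin 2) K) * w), hγu', (htrdet _).1, (htrdet _).2, hdeep', ?_, hsymv'⟩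
    rw [hre, coe_flip_inv_mul_mul_flip_apply hw hw', show Fin.rev (1 : Fin 2) = 0 from rfl, show Fin.rev (0 : Fin 2) = 1 from rfl]
    exact h01

end Literature.NumberTheory.Rogawski1990.TypeOneRamifiedJunction

end
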